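import Literature.NumberTheory.Sieve.DrappeauDispersion
import HarnessLib

/-!
# Drappeau 2017, §5.3: orthogonality for pairs of small-conductor characters to two moduli — proved

S. Drappeau, *Sums of Kloosterman sums in arithmetic progressions, and the error term in the
dispersion method*, Proc. London Math. Soc. (3) 114 (2017) 684–732 = arXiv:1504.05549
(`Drappeau2017`; held as `paper:arxiv-1504.05549`, §5.3.1 read on chunk 18).

This file is the first brick, in the printed order, of the proof of **Theorem 5.1**
(`Literature.NumberTheory.Sieve.Drappeau2017_theorem51`, a named fact of
`Literature.NumberTheory.Sieve.DrappeauDispersion`).  After Cauchy–Schwarz ((5.10)–(5.11)) the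
dispersion sums `𝒮₂`, `𝒮₃` of §5.3 carry, for two moduli `q₁, q₂` and `W = [q₁, q₂]`, the
character sums over `b mod W`, `(b, W) = 1`, of products `χ₁(b n₁) χ̄₂(b n₂)` with
`χⱼ ∈ 𝒳_{qⱼ}(R) = {χ mod qⱼ : cond χ ≤ R}`.  §5.3.1 evaluates them (p. 18 of the arXiv version):

* "By orthogonality, `∑_{b mod W, (b,W)=1} χ₁χ̄₂(b) = φ(W) 1_{χ₁ ∼ χ₂}` where by `χ₁ ∼ χ₂` we mean
  that `χ₁` and `χ₂` are induced by the same primitive character – which necessarily has conductor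
  dividing `(q₁, q₂)`" — `sum_units_changeLevel_mul_inv` (for any common multiple `W` of
  `q₁, q₂`; `χ₁ ∼ χ₂` is rendered as the equality of the two lifts to level `W`, which is
  equivalent to equality of the lifts to `[q₁, q₂]`, `changeLevel_eq_iff_lcm`).
* "Therefore `∑_{χ₁ ∈ 𝒳_{q₁}(R), χ₂ ∈ 𝒳_{q₂}(R)} χ₁(n₁) χ̄₂(n₂) 1_{χ₁ ∼ χ₂}
  = ∑_{χ₀ ∈ 𝒳_{(q₁,q₂)}(R)} χ₀(n₁ n̄₂)`" ((5.15), for `(nⱼ, qⱼ) = 1`) —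
  `sum_sum_ite_changeLevel_eq_sum_gcd_changeLevel` (for an arbitrary summand `F(χ₁, χ₂)`: the
  pairs `χ₁ ∼ χ₂` are exactly the pairs of lifts of the characters `χ₀ mod (q₁, q₂)`, with the same
  conductor — Mathlib's `factorsThrough_gcd`, `conductor_changeLevel`).
* The two combined, as they enter `X₃` ((5.16)):
  `∑_{χ₁, χ₂} ∑_{b} χ₁(b n₁) χ̄₂(b n₂) = φ(W) ∑_{χ₀ ∈ 𝒳_{(q₁,q₂)}(R)} χ₀(n₁) χ̄₀(n₂)` —
  `sum_sum_sum_units_eq`.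
* §5.3.2 (p. 19), the sum over a class: "`∑_{b mod W, (b,W)=1, b ≡ n̄₁ (q₁)} χ₂(b)
  = (φ(q₂)/φ((q₁,q₂))) 1_{q̃₂ ∣ (q₁,q₂)} χ̃₂(n̄₁)`" — `sum_units_filter_cast_eq` (with the factor
  `φ(W)/φ(q₁)`, equal to the printed one for `W = [q₁, q₂]`, and the right side written as the sum
  of `χ₁(c)` over the at most one `χ₁ mod q₁` with `χ₁ ∼ χ₂`), and its sum over `χ₂ ∈ 𝒳_{q₂}(R)`
  against `χ₂(n₂)`, "`= (φ(q₂)/φ((q₁,q₂))) ∑_{χ₀ ∈ 𝒳_{(q₁,q₂)}(R)} χ₀(n̄₁ n₂)`, and so `X₂ = X₃`" —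
  `sum_mul_sum_units_filter_eq`.

Conjugates are written as inverses, `χ̄(t) = χ(t)⁻¹` (`conj_apply_eq_inv`, valid for every `t`
since `χ(t) = 0` off the units and `0⁻¹ = 0`).  The sets `𝒳_q(R)` are written inline as
`univ.filter (cond · ≤ R)`, matching `Drappeau2017.mainKernel`; the indicator `1_{χ₁ ∼ χ₂}` takes a
`DecidableEq` instance on the characters of level `W` as a hypothesis (supplied by `Classical`).
All statements hold for any common multiple `W ≠ 0` of `q₁, q₂`, not only `W = [q₁, q₂]`.

Not here: the Poisson-summation and Gauss-sum steps of §5.3 (analytic), the definitions of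
`𝒮ᵢ, Xᵢ` and Theorem 5.1 itself.

## References

* S. Drappeau, Proc. London Math. Soc. (3) 114 (2017) 684–732, arXiv:1504.05549, §5.3.1,
  (5.15)–(5.16). [Drappeau2017]
-/

noncomputable section

open Finset DirichletCharacter

namespace Literature.NumberTheory.Sieve

namespace Drappeau2017

/-! ### Conjugate values -/

/-- For a Dirichlet character with complex values, `χ̄(t) = χ(t)⁻¹` for every `t`
(a root of unity on units, `0 = 0⁻¹` on non-units). [folklore] -/
theorem conj_apply_eq_inv {n : ℕ} (χ : DirichletCharacter ℂ n) (t : ZMod n) :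
    starRingEnd ℂ (χ t) = (χ t)⁻¹ := by
  by_cases ht : IsUnit t
  · have h1 : ‖χ t‖ = 1 := by
      obtain ⟨u, rfl⟩ := ht
      exact χ.unit_norm_eq_one u
    exact (Complex.inv_eq_conj h1).symm
  · rw [MulChar.map_nonunit χ ht, map_zero, inv_zero]

/-! ### Sums of a character over the units -/

/-- A multiplicative character summed over the units equals its sum over the whole ring `ZMod W`
(it vanishes off the units). [folklore] -/
theorem sum_units_eq_sum_univ {W : ℕ} [NeZero W] (ψ : DirichletCharacter ℂ W) :
    ∑ b : (ZMod W)ˣ, ψ (b : ZMod W) = ∑ a : ZMod W, ψ a := by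
  classical
  have hmap : ∑ b : (ZMod W)ˣ, ψ (b : ZMod W) =
      ∑ a ∈ (univ : Finset (ZMod W)ˣ).map ⟨((↑) : (ZMod W)ˣ → ZMod W), Units.val_injective⟩,
        ψ a := by
    rw [Finset.sum_map]
    rfl
  rw [hmap]
  refine Finset.sum_subset (Finset.subset_univ _) fun a _ ha => ?_
  apply MulChar.map_nonunit
  intro hu
  apply ha
  exact Finset.mem_map.2 ⟨hu.unit, Finset.mem_univ _, rfl⟩

/-- Orthogonality over the group of units: `∑_{b mod W, (b,W)=1} ψ(b) = φ(W)` if `ψ` is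
principal and `0` otherwise. [folklore] -/
theorem sum_units_eq_ite {W : ℕ} [NeZero W] [DecidableEq (DirichletCharacter ℂ W)]
    (ψ : DirichletCharacter ℂ W) :
    ∑ b : (ZMod W)ˣ, ψ (b : ZMod W) = if ψ = 1 then (Nat.totient W : ℂ) else 0 := by
  classical
  rw [sum_units_eq_sum_univ]
  split_ifs with h
  · rw [h, MulChar.sum_one_eq_card_units, ZMod.card_units_eq_totient]
  · exact MulChar.sum_eq_zero_of_ne_one h

/-! ### `χ₁ ∼ χ₂`: the same induced character at a common level -/

/-- Two characters `χ₁ mod q₁`, `χ₂ mod q₂` induce the same character at one common level `W`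
iff they do at the least common level `[q₁, q₂]` (this is the relation "`χ₁ ∼ χ₂`: induced by
the same primitive character" of Drappeau §5.3.1). [cite: Drappeau2017, §5.3.1] -/
theorem changeLevel_eq_iff_lcm {q₁ q₂ W : ℕ} [NeZero W] (h₁ : q₁ ∣ W) (h₂ : q₂ ∣ W)
    (χ₁ : DirichletCharacter ℂ q₁) (χ₂ : DirichletCharacter ℂ q₂) :
    changeLevel h₁ χ₁ = changeLevel h₂ χ₂ ↔
      changeLevel (Nat.dvd_lcm_left q₁ q₂) χ₁ = changeLevel (Nat.dvd_lcm_right q₁ q₂) χ₂ := by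
  have hL : Nat.lcm q₁ q₂ ∣ W := Nat.lcm_dvd h₁ h₂
  have e₁ : changeLevel h₁ χ₁ = changeLevel hL (changeLevel (Nat.dvd_lcm_left q₁ q₂) χ₁) := by
    rw [← changeLevel_trans]
  have e₂ : changeLevel h₂ χ₂ = changeLevel hL (changeLevel (Nat.dvd_lcm_right q₁ q₂) χ₂) := by
    rw [← changeLevel_trans]
  rw [e₁, e₂]
  exact ⟨fun h => changeLevel_injective hL h, fun h => by rw [h]⟩

/-- **Orthogonality for a pair of characters to two moduli** (Drappeau §5.3.1: "By orthogonality,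
`∑_{b mod W, (b,W)=1} χ₁χ̄₂(b) = φ(W) 1_{χ₁ ∼ χ₂}`"), for any common multiple `W` of `q₁, q₂`,
the characters being read on `(ℤ/Wℤ)ˣ` through their lifts. [cite: Drappeau2017, §5.3.1] -/
theorem sum_units_changeLevel_mul_inv {q₁ q₂ W : ℕ} [NeZero W]
    [DecidableEq (DirichletCharacter ℂ W)] (h₁ : q₁ ∣ W) (h₂ : q₂ ∣ W)
    (χ₁ : DirichletCharacter ℂ q₁) (χ₂ : DirichletCharacter ℂ q₂) :
    ∑ b : (ZMod W)ˣ, changeLevel h₁ χ₁ (b : ZMod W) * (changeLevel h₂ χ₂ (b : ZMod W))⁻¹ =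
      if changeLevel h₁ χ₁ = changeLevel h₂ χ₂ then (Nat.totient W : ℂ) else 0 := by
  have hsum : ∑ b : (ZMod W)ˣ, changeLevel h₁ χ₁ (b : ZMod W) * (changeLevel h₂ χ₂ (b : ZMod W))⁻¹ =
      ∑ b : (ZMod W)ˣ, (changeLevel h₁ χ₁ * (changeLevel h₂ χ₂)⁻¹) (b : ZMod W) := by
    refine Finset.sum_congr rfl fun b _ => ?_
    rw [MulChar.coeToFun_mul, Pi.mul_apply, MulChar.inv_apply_eq_inv']
  rw [hsum, sum_units_eq_ite]
  by_cases h : changeLevel h₁ χ₁ = changeLevel h₂ χ₂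
  · rw [if_pos h, if_pos (by rw [h, mul_inv_cancel])]
  · rw [if_neg h, if_neg (fun h' => h (mul_inv_eq_one.1 h'))]

/-- The same with the characters evaluated at the reductions of `b`:
`∑_{b mod W, (b,W)=1} χ₁(b mod q₁) χ₂(b mod q₂)⁻¹ = φ(W) 1_{χ₁ ∼ χ₂}`.
[cite: Drappeau2017, §5.3.1] -/
theorem sum_units_cast_mul_inv {q₁ q₂ W : ℕ} [NeZero W] [DecidableEq (DirichletCharacter ℂ W)]
    (h₁ : q₁ ∣ W) (h₂ : q₂ ∣ W) (χ₁ : DirichletCharacter ℂ q₁) (χ₂ : DirichletCharacter ℂ q₂) :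
    ∑ b : (ZMod W)ˣ, χ₁ ((b : ZMod W).cast : ZMod q₁) * (χ₂ ((b : ZMod W).cast : ZMod q₂))⁻¹ =
      if changeLevel h₁ χ₁ = changeLevel h₂ χ₂ then (Nat.totient W : ℂ) else 0 := by
  rw [← sum_units_changeLevel_mul_inv h₁ h₂]
  refine Finset.sum_congr rfl fun b _ => ?_
  rw [changeLevel_eq_cast_of_dvd χ₁ h₁, changeLevel_eq_cast_of_dvd χ₂ h₂]

/-! ### (5.15): the pairs `χ₁ ∼ χ₂` are the lifts of the characters `mod (q₁, q₂)` -/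

/-- **The pairs `χ₁ ∼ χ₂` with `cond ≤ R` are the lifts of `𝒳_{(q₁,q₂)}(R)`** (the mechanism of
Drappeau (5.15)): for any common multiple `W ≠ 0` of `q₁, q₂` (at which `∼` is read) and any
summand `F`,
`∑_{χ₁ ∈ 𝒳_{q₁}(R)} ∑_{χ₂ ∈ 𝒳_{q₂}(R)} 1_{χ₁ ∼ χ₂} F(χ₁, χ₂)
  = ∑_{χ₀ ∈ 𝒳_{(q₁,q₂)}(R)} F(χ₀ mod q₁, χ₀ mod q₂)`:
the map `χ₀ ↦ (χ₀ mod q₁, χ₀ mod q₂)` is a bijection from the characters `mod (q₁, q₂)` onto the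
pairs `χ₁ ∼ χ₂` (Mathlib's `factorsThrough_gcd`, `changeLevel_injective`), preserving conductors
(`conductor_changeLevel`). [cite: Drappeau2017, §5.3.1 (5.15)] -/
theorem sum_sum_ite_changeLevel_eq_sum_gcd_changeLevel {q₁ q₂ W : ℕ} [NeZero W]
    [DecidableEq (DirichletCharacter ℂ W)] (h₁ : q₁ ∣ W) (h₂ : q₂ ∣ W) (R : ℝ)
    (F : DirichletCharacter ℂ q₁ → DirichletCharacter ℂ q₂ → ℂ) :
    ∑ χ₁ ∈ (univ.filter fun χ : DirichletCharacter ℂ q₁ => (χ.conductor : ℝ) ≤ R),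
      ∑ χ₂ ∈ (univ.filter fun χ : DirichletCharacter ℂ q₂ => (χ.conductor : ℝ) ≤ R),
        (if changeLevel h₁ χ₁ = changeLevel h₂ χ₂ then F χ₁ χ₂ else 0) =
      ∑ χ₀ ∈ (univ.filter fun χ : DirichletCharacter ℂ (Nat.gcd q₁ q₂) => (χ.conductor : ℝ) ≤ R),
        F (changeLevel (Nat.gcd_dvd_left q₁ q₂) χ₀) (changeLevel (Nat.gcd_dvd_right q₁ q₂) χ₀) := by
  classical
  haveI hq₁ : NeZero q₁ := ⟨fun h => NeZero.ne W (Nat.eq_zero_of_zero_dvd (h ▸ h₁))⟩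
  haveI hq₂ : NeZero q₂ := ⟨fun h => NeZero.ne W (Nat.eq_zero_of_zero_dvd (h ▸ h₂))⟩
  have hg₁ : Nat.gcd q₁ q₂ ∣ q₁ := Nat.gcd_dvd_left q₁ q₂
  have hg₂ : Nat.gcd q₁ q₂ ∣ q₂ := Nat.gcd_dvd_right q₁ q₂
  -- the double sum with the indicator as a sum over the set of pairs `χ₁ ∼ χ₂`
  have hLHS : ∑ p ∈ ((univ.filter fun χ : DirichletCharacter ℂ q₁ => (χ.conductor : ℝ) ≤ R) ×ˢ
        (univ.filter fun χ : DirichletCharacter ℂ q₂ => (χ.conductor : ℝ) ≤ R)).filter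
          (fun p => changeLevel h₁ p.1 = changeLevel h₂ p.2), F p.1 p.2 =
      ∑ χ₁ ∈ (univ.filter fun χ : DirichletCharacter ℂ q₁ => (χ.conductor : ℝ) ≤ R),
        ∑ χ₂ ∈ (univ.filter fun χ : DirichletCharacter ℂ q₂ => (χ.conductor : ℝ) ≤ R),
          (if changeLevel h₁ χ₁ = changeLevel h₂ χ₂ then F χ₁ χ₂ else 0) :=
    (Finset.sum_filter _ _).trans (Finset.sum_product' _ _ (fun χ₁ χ₂ =>
      if changeLevel h₁ χ₁ = changeLevel h₂ χ₂ then F χ₁ χ₂ else 0))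
  rw [← hLHS]
  symm
  -- the bijection `χ₀ ↦ (χ₀ mod q₁, χ₀ mod q₂)` from `𝒳_{(q₁,q₂)}(R)` onto the pairs
  refine Finset.sum_nbij (fun χ₀ => (changeLevel hg₁ χ₀, changeLevel hg₂ χ₀)) ?_ ?_ ?_
    (fun χ₀ _ => rfl)
  · -- maps into
    intro χ₀ hχ₀
    rw [Finset.mem_filter] at hχ₀
    rw [Finset.mem_filter, Finset.mem_product, Finset.mem_filter, Finset.mem_filter]
    refine ⟨⟨⟨Finset.mem_univ _, ?_⟩, ⟨Finset.mem_univ _, ?_⟩⟩, ?_⟩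
    · rw [conductor_changeLevel]; exact hχ₀.2
    · rw [conductor_changeLevel]; exact hχ₀.2
    · change changeLevel h₁ (changeLevel hg₁ χ₀) = changeLevel h₂ (changeLevel hg₂ χ₀)
      rw [← changeLevel_trans, ← changeLevel_trans]
  · -- injective
    intro χ₀ _ χ₀' _ h
    exact changeLevel_injective hg₁ (Prod.mk.inj h).1
  · -- surjective
    intro p hp
    rw [Finset.mem_coe, Finset.mem_filter, Finset.mem_product, Finset.mem_filter,
      Finset.mem_filter] at hp
    obtain ⟨⟨⟨-, hc₁⟩, -⟩, hsim⟩ := hp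
    -- `χ₁ ∼ χ₂` at level `W` ⇒ at level `[q₁, q₂]` ⇒ at level `q₁ q₂`
    have hL : Nat.lcm q₁ q₂ ∣ q₁ * q₂ :=
      Nat.lcm_dvd (Nat.dvd_mul_right q₁ q₂) (Nat.dvd_mul_left q₂ q₁)
    have hmul : changeLevel (Nat.dvd_mul_right q₁ q₂) p.1 =
        changeLevel (Nat.dvd_mul_left q₂ q₁) p.2 := by
      rw [changeLevel_trans p.1 (Nat.dvd_lcm_left q₁ q₂) hL,
        changeLevel_trans p.2 (Nat.dvd_lcm_right q₁ q₂) hL,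
        (changeLevel_eq_iff_lcm h₁ h₂ p.1 p.2).1 hsim]
    obtain ⟨hg', χ₀, hχ₀⟩ := factorsThrough_gcd p.1 p.2 hmul
    refine ⟨χ₀, ?_, ?_⟩
    · rw [Finset.mem_coe, Finset.mem_filter, ← conductor_changeLevel χ₀ hg₁, ← hχ₀]
      exact ⟨Finset.mem_univ _, hc₁⟩
    · have e₁ : changeLevel hg₁ χ₀ = p.1 := hχ₀.symm
      have e₂ : changeLevel hg₂ χ₀ = p.2 := by
        apply changeLevel_injective h₂
        rw [← changeLevel_trans, ← hsim, ← e₁, ← changeLevel_trans]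
      exact Prod.ext e₁ e₂

/-- **The character sums of `X₃`** (Drappeau §5.3.1, the step from the definition of `X₃` to
(5.16)): for `(n₁, q₁) = (n₂, q₂) = 1` and any common multiple `W ≠ 0` of `q₁, q₂`,
`∑_{χ₁ ∈ 𝒳_{q₁}(R)} ∑_{χ₂ ∈ 𝒳_{q₂}(R)} ∑_{b mod W, (b,W)=1} χ₁(b n₁) χ₂(b n₂)⁻¹
  = φ(W) ∑_{χ₀ ∈ 𝒳_{(q₁,q₂)}(R)} χ₀(n₁) χ₀(n₂)⁻¹`. [cite: Drappeau2017, §5.3.1 (5.15)–(5.16)] -/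
theorem sum_sum_sum_units_eq {q₁ q₂ W : ℕ} [NeZero W] (h₁ : q₁ ∣ W) (h₂ : q₂ ∣ W)
    (R : ℝ) {n₁ n₂ : ℤ} (hn₁ : IsCoprime n₁ q₁) (hn₂ : IsCoprime n₂ q₂) :
    ∑ χ₁ ∈ (univ.filter fun χ : DirichletCharacter ℂ q₁ => (χ.conductor : ℝ) ≤ R),
      ∑ χ₂ ∈ (univ.filter fun χ : DirichletCharacter ℂ q₂ => (χ.conductor : ℝ) ≤ R),
        ∑ b : (ZMod W)ˣ, χ₁ (((b : ZMod W).cast : ZMod q₁) * (n₁ : ZMod q₁)) *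
          (χ₂ (((b : ZMod W).cast : ZMod q₂) * (n₂ : ZMod q₂)))⁻¹ =
      (Nat.totient W : ℂ) *
        ∑ χ₀ ∈ (univ.filter fun χ : DirichletCharacter ℂ (Nat.gcd q₁ q₂) => (χ.conductor : ℝ) ≤ R),
          χ₀ (n₁ : ZMod (Nat.gcd q₁ q₂)) * (χ₀ (n₂ : ZMod (Nat.gcd q₁ q₂)))⁻¹ := by
  classical
  have h515 := sum_sum_ite_changeLevel_eq_sum_gcd_changeLevel h₁ h₂ R
    (fun χ₁ χ₂ => χ₁ (n₁ : ZMod q₁) * (χ₂ (n₂ : ZMod q₂))⁻¹)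
  simp only [changeLevel_eq_cast_of_dvd' _ _ hn₁, changeLevel_eq_cast_of_dvd' _ _ hn₂] at h515
  rw [← h515, Finset.mul_sum]
  refine Finset.sum_congr rfl fun χ₁ _ => ?_
  rw [Finset.mul_sum]
  refine Finset.sum_congr rfl fun χ₂ _ => ?_
  have hinner : ∑ b : (ZMod W)ˣ, χ₁ (((b : ZMod W).cast : ZMod q₁) * (n₁ : ZMod q₁)) *
      (χ₂ (((b : ZMod W).cast : ZMod q₂) * (n₂ : ZMod q₂)))⁻¹ =
      (χ₁ (n₁ : ZMod q₁) * (χ₂ (n₂ : ZMod q₂))⁻¹) * ∑ b : (ZMod W)ˣ,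
        χ₁ ((b : ZMod W).cast : ZMod q₁) * (χ₂ ((b : ZMod W).cast : ZMod q₂))⁻¹ := by
    rw [Finset.mul_sum]
    refine Finset.sum_congr rfl fun b _ => ?_
    rw [map_mul, map_mul, mul_inv]
    ring
  rw [hinner, sum_units_cast_mul_inv h₁ h₂]
  split_ifs <;> ring

/-! ### §5.3.2: the character sum over a class `b ≡ c (mod q₁)` -/

/-- `χ(a⁻¹) = χ(a)⁻¹` for a unit `a` of `ZMod n`. [folklore] -/
theorem apply_inv_of_isUnit {n : ℕ} (χ : DirichletCharacter ℂ n) {a : ZMod n} (ha : IsUnit a) :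
    χ a⁻¹ = (χ a)⁻¹ := by
  obtain ⟨u, rfl⟩ := ha
  rw [ZMod.inv_coe_unit, map_units_inv]

/-- The reduction `mod q₁` of a unit `mod W` is a unit when `q₁ ∣ W`. [folklore] -/
theorem isUnit_cast_of_dvd {q₁ W : ℕ} (h₁ : q₁ ∣ W) (b : (ZMod W)ˣ) :
    IsUnit ((b : ZMod W).cast : ZMod q₁) := by
  rw [← ZMod.unitsMap_val h₁ b]
  exact Units.isUnit _

/-- **The class-restricted orthogonality of §5.3.2** (Drappeau, p. 19: "If `S` denotes the sum over
`b` above, then `S = χ₂(c)S` for any `c mod W`, `(c,W)=1`, `c ≡ 1 mod q₁`. Thus `S = 0` if `χ₂` is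
not `q₁`-periodic … If on the contrary `q̃₂ ∣ (q₁, q₂)`, then `S = χ̃₂(n̄₁) φ(W)/φ(q₁)`"): for
`q₁, q₂ ∣ W`, any class `c mod q₁` and any `χ₂ mod q₂`,
`∑_{b mod W, (b,W)=1, b ≡ c (q₁)} χ₂(b) = (φ(W)/φ(q₁)) ∑_{χ₁ mod q₁, χ₁ ∼ χ₂} χ₁(c)`
(at most one `χ₁ mod q₁` satisfies `χ₁ ∼ χ₂`, namely the character induced by `χ̃₂` when
`cond χ₂ ∣ q₁`; both sides vanish for a non-unit class `c`).  Proof: detect the class by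
orthogonality `mod q₁` (`DirichletCharacter.sum_char_inv_mul_char_eq`) and apply
`sum_units_cast_mul_inv`. [cite: Drappeau2017, §5.3.2] -/
theorem sum_units_filter_cast_eq {q₁ q₂ W : ℕ} [NeZero W] [DecidableEq (DirichletCharacter ℂ W)]
    (h₁ : q₁ ∣ W) (h₂ : q₂ ∣ W) (χ₂ : DirichletCharacter ℂ q₂) (c : ZMod q₁) :
    ∑ b ∈ (univ : Finset (ZMod W)ˣ).filter
        (fun b : (ZMod W)ˣ => ((b : ZMod W).cast : ZMod q₁) = c), χ₂ ((b : ZMod W).cast : ZMod q₂) =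
      (Nat.totient W : ℂ) / (Nat.totient q₁ : ℂ) *
        ∑ χ₁ : DirichletCharacter ℂ q₁,
          if changeLevel h₁ χ₁ = changeLevel h₂ χ₂ then χ₁ c else 0 := by
  haveI hq₁ : NeZero q₁ := ⟨fun h => NeZero.ne W (Nat.eq_zero_of_zero_dvd (h ▸ h₁))⟩
  have hφ : (Nat.totient q₁ : ℂ) ≠ 0 := by
    exact_mod_cast (Nat.totient_pos.2 (NeZero.pos q₁)).ne'
  -- detect the class `b ≡ c (mod q₁)` by orthogonality of the characters `mod q₁`
  have hind : ∀ b : (ZMod W)ˣ,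
      (if ((b : ZMod W).cast : ZMod q₁) = c then χ₂ ((b : ZMod W).cast : ZMod q₂) else 0) =
        ((Nat.totient q₁ : ℂ))⁻¹ * ∑ χ₁ : DirichletCharacter ℂ q₁,
          χ₁ c * (χ₂ ((b : ZMod W).cast : ZMod q₂) * (χ₁ ((b : ZMod W).cast : ZMod q₁))⁻¹) := by
    intro b
    have hu := isUnit_cast_of_dvd h₁ b
    have hre : ∑ χ₁ : DirichletCharacter ℂ q₁,
        χ₁ c * (χ₂ ((b : ZMod W).cast : ZMod q₂) * (χ₁ ((b : ZMod W).cast : ZMod q₁))⁻¹) =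
        χ₂ ((b : ZMod W).cast : ZMod q₂) *
          ∑ χ₁ : DirichletCharacter ℂ q₁, χ₁ ((b : ZMod W).cast : ZMod q₁)⁻¹ * χ₁ c := by
      rw [Finset.mul_sum]
      refine Finset.sum_congr rfl fun χ₁ _ => ?_
      rw [apply_inv_of_isUnit χ₁ hu]
      ring
    rw [hre, DirichletCharacter.sum_char_inv_mul_char_eq ℂ hu c]
    split_ifs
    · field_simp
    · simp
  calc ∑ b ∈ (univ : Finset (ZMod W)ˣ).filter
          (fun b : (ZMod W)ˣ => ((b : ZMod W).cast : ZMod q₁) = c), χ₂ ((b : ZMod W).cast : ZMod q₂)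
      = ∑ b : (ZMod W)ˣ, ((Nat.totient q₁ : ℂ))⁻¹ * ∑ χ₁ : DirichletCharacter ℂ q₁,
          χ₁ c * (χ₂ ((b : ZMod W).cast : ZMod q₂) * (χ₁ ((b : ZMod W).cast : ZMod q₁))⁻¹) :=
        (Finset.sum_filter _ _).trans (Finset.sum_congr rfl fun b _ => hind b)
    _ = ((Nat.totient q₁ : ℂ))⁻¹ * ∑ χ₁ : DirichletCharacter ℂ q₁, χ₁ c * ∑ b : (ZMod W)ˣ,
          χ₂ ((b : ZMod W).cast : ZMod q₂) * (χ₁ ((b : ZMod W).cast : ZMod q₁))⁻¹ := by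
        rw [← Finset.mul_sum, Finset.sum_comm]
        simp only [Finset.mul_sum]
    _ = (Nat.totient W : ℂ) / (Nat.totient q₁ : ℂ) * ∑ χ₁ : DirichletCharacter ℂ q₁,
          if changeLevel h₁ χ₁ = changeLevel h₂ χ₂ then χ₁ c else 0 := by
        simp only [sum_units_cast_mul_inv h₂ h₁ χ₂, div_eq_mul_inv, Finset.mul_sum]
        refine Finset.sum_congr rfl fun χ₁ _ => ?_
        by_cases h : changeLevel h₁ χ₁ = changeLevel h₂ χ₂
        · rw [if_pos h, if_pos h.symm]; ring
        · rw [if_neg h, if_neg (fun h' => h h'.symm)]; ring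

/-- **The character sums of `X₂` equal those of `X₃`** (Drappeau §5.3.2, last two displays:
"Summing over `χ₂ ∈ 𝒳_{q₂}(R)` and since `(n₁n₂, (q₁, q₂)) = 1`, we obtain
`∑_{χ₂ ∈ 𝒳_{q₂}(R)} χ₂(n₂) ∑_{b mod W, (b,W)=1, b ≡ n̄₁ (q₁)} χ₂(b)
 = (φ(q₂)/φ((q₁,q₂))) ∑_{χ₀ ∈ 𝒳_{(q₁,q₂)}(R)} χ₀(n̄₁ n₂)`, and so `X₂ = X₃`"): for `q₁, q₂ ∣ W ≠ 0`,
an integer `c` coprime to `q₁` (the class; `c = n̄₁` in the source) and `(n₂, q₂) = 1`,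
`∑_{χ₂ ∈ 𝒳_{q₂}(R)} χ₂(n₂) ∑_{b mod W, (b,W)=1, b ≡ c (q₁)} χ₂(b)
  = (φ(W)/φ(q₁)) ∑_{χ₀ ∈ 𝒳_{(q₁,q₂)}(R)} χ₀(c) χ₀(n₂)`.
(For `W = [q₁, q₂]`, `φ(W)/φ(q₁) = φ(q₂)/φ((q₁, q₂))`.)  The pairs `χ₁ ∼ χ₂` have equal conductors,
so the filter `cond χ₁ ≤ R` may be inserted and `sum_sum_ite_changeLevel_eq_sum_gcd_changeLevel`
applies. [cite: Drappeau2017, §5.3.2] -/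
theorem sum_mul_sum_units_filter_eq {q₁ q₂ W : ℕ} [NeZero W] (h₁ : q₁ ∣ W) (h₂ : q₂ ∣ W)
    (R : ℝ) {c n₂ : ℤ} (hc : IsCoprime c q₁) (hn₂ : IsCoprime n₂ q₂) :
    ∑ χ₂ ∈ (univ.filter fun χ : DirichletCharacter ℂ q₂ => (χ.conductor : ℝ) ≤ R),
      χ₂ (n₂ : ZMod q₂) * ∑ b ∈ (univ : Finset (ZMod W)ˣ).filter
          (fun b : (ZMod W)ˣ => ((b : ZMod W).cast : ZMod q₁) = ((c : ℤ) : ZMod q₁)),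
            χ₂ ((b : ZMod W).cast : ZMod q₂) =
      (Nat.totient W : ℂ) / (Nat.totient q₁ : ℂ) *
        ∑ χ₀ ∈ (univ.filter fun χ : DirichletCharacter ℂ (Nat.gcd q₁ q₂) => (χ.conductor : ℝ) ≤ R),
          χ₀ (c : ZMod (Nat.gcd q₁ q₂)) * χ₀ (n₂ : ZMod (Nat.gcd q₁ q₂)) := by
  haveI : DecidableEq (DirichletCharacter ℂ W) := Classical.decEq _
  haveI hq₁ : NeZero q₁ := ⟨fun h => NeZero.ne W (Nat.eq_zero_of_zero_dvd (h ▸ h₁))⟩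
  -- the class sums (`sum_units_filter_cast_eq`), then insert the filter `cond χ₁ ≤ R`
  -- (pairs `χ₁ ∼ χ₂` have the same conductor) and distribute
  have hstep : ∀ χ₂ ∈ (univ.filter fun χ : DirichletCharacter ℂ q₂ => (χ.conductor : ℝ) ≤ R),
      χ₂ (n₂ : ZMod q₂) * ∑ b ∈ (univ : Finset (ZMod W)ˣ).filter
          (fun b : (ZMod W)ˣ => ((b : ZMod W).cast : ZMod q₁) = ((c : ℤ) : ZMod q₁)),
            χ₂ ((b : ZMod W).cast : ZMod q₂) =
      (Nat.totient W : ℂ) / (Nat.totient q₁ : ℂ) *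
        ∑ χ₁ ∈ (univ.filter fun χ : DirichletCharacter ℂ q₁ => (χ.conductor : ℝ) ≤ R),
          (if changeLevel h₁ χ₁ = changeLevel h₂ χ₂ then
            χ₁ (c : ZMod q₁) * χ₂ (n₂ : ZMod q₂) else 0) := by
    intro χ₂ hχ₂
    rw [Finset.mem_filter] at hχ₂
    rw [sum_units_filter_cast_eq h₁ h₂ χ₂ ((c : ℤ) : ZMod q₁), mul_left_comm, Finset.mul_sum,
      Finset.sum_filter]
    congr 1
    refine Finset.sum_congr rfl fun χ₁ _ => ?_
    by_cases hsim : changeLevel h₁ χ₁ = changeLevel h₂ χ₂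
    · have hcond : ((conductor χ₁ : ℕ) : ℝ) ≤ R := by
        rw [← conductor_changeLevel χ₁ h₁, hsim, conductor_changeLevel]; exact hχ₂.2
      rw [if_pos hsim, if_pos hcond, if_pos hsim]; ring
    · rw [if_neg hsim]; split_ifs <;> simp
  rw [Finset.sum_congr rfl hstep, ← Finset.mul_sum, Finset.sum_comm,
    sum_sum_ite_changeLevel_eq_sum_gcd_changeLevel h₁ h₂ R
      (fun χ₁ χ₂ => χ₁ (c : ZMod q₁) * χ₂ (n₂ : ZMod q₂))]
  congr 1
  refine Finset.sum_congr rfl fun χ₀ _ => ?_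
  rw [changeLevel_eq_cast_of_dvd' χ₀ _ hc, changeLevel_eq_cast_of_dvd' χ₀ _ hn₂]

end Drappeau2017

end Literature.NumberTheory.Sieve

end
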